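import Summits.HodgeConjecture.HodgeConjecture.Theorems.DworkReflectionQuotientsK2OfConeSpan
import Literature.AlgebraicGeometry.HodgeTheory.FermatConeSpanRepresentsLeftHolds

/-!
# Crux K2 `FlatClassesSpannedByReflectionInvariants` of the route `DworkReflectionQuotients`, and its child `TypeOneHodge` — PROVED

Route `route-HodgeConjecture-DworkReflectionQuotients` (cell `hodge-nonav`; FRONTIER rung F-H1 — never summit
credit), items `stmt-HodgeConjecture-20241` (crux K2 `FlatClassesSpannedByReflectionInvariants`) and
`stmt-HodgeConjecture-21152` (child 2 `TypeOneHodge`). Prover seat `hodge-nonav-20241-p1` (g6), 2026-08-27.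
UNCONDITIONAL: no named fact is taken as a hypothesis.

The chain (all in the tree): child 1 `TopCharacterTrivial` (p561800) and the glue (p558766) reduce K2 to
child 2 `TypeOneHodge`; `…K2TopCharacter` / `…TypeOneHodgeOfFermat` reduce child 2 to four claims on the
Fermat sextic fourfold `X⁴₆`; `Literature/…/FermatFourfoldConeClaims` derives the four claims from the
cone-span leaf (III-l) `Shioda1979_coneSpan_represents_left` (Aoki 1987, Thm. 1-4 (i), `r = 0`: cones
over Hodge eigenlines of the Fermat sextic SURFACE, Aoki–Shioda (2.1)), packaged as
`typeOneHodge_of_coneSpan` / `flatClassesSpannedByReflectionInvariants_of_coneSpan`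
(`…K2OfConeSpan`, p568987); and the leaf is now a THEOREM,
`Literature.AlgebraicGeometry.HodgeTheory.Shioda1979_coneSpan_represents_left_holds`
(`Literature/…/FermatConeSpanRepresentsLeftHolds`: the blown-up cone over `X²ˢₘ` inside the vertex
blow-up of `ℙ^{2s+2}`, de Jong 1996 Lemma 4.11, mapped to `X^{2s+2}ₘ ∩ {x₁ = ε x₀}`).

* `typeOneHodge_proof` — child 2 `TypeOneHodge` (stmt-HodgeConjecture-21152);
* `flatClassesSpannedByReflectionInvariants_proof` — the crux K2 (stmt-HodgeConjecture-20241).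

Honest framing: this proves that the 1170-dimensional flat part of `H⁴` of every Dwork sextic fourfold
`X_ψ` (`ψ⁶ ≠ 1`) is spanned by reflection-invariant rational `(2,2)`-classes — one of the two cruxes of a
FRONTIER-rung route (F-H1); nothing here says HC, HC_CM or HC_AV is proved.

## References

* N. Aoki, *Some new algebraic cycles on Fermat varieties*, J. Math. Soc. Japan 39 (1987), Thm. 1-4 (i)
  p. 388, p. 386. [Aoki1987]
* N. Aoki, T. Shioda, *Generators of the Néron–Severi group of a Fermat surface*, Progr. Math. 35 (1983),
  §2 (2.1). [AokiShioda1983]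
* N. M. Katz, *Another look at the Dwork family*, Progr. Math. 270 (2009), §3, Lemma 3.1. [Katz2009]
* T. Shioda, *The Hodge conjecture for Fermat varieties*, Math. Ann. 245 (1979), Thm. I. [Shioda1979HodgeFermat]
* A. J. de Jong, *Smoothness, semi-stability and alterations*, Publ. Math. IHÉS 83 (1996), Lemma 4.11. [DeJong1996]
-/

namespace Summit.HodgeConjecture.HodgeConjecture.Theorems

open Literature.AlgebraicGeometry.HodgeTheory

/-- **Child 2 `TypeOneHodge` of crux K2, PROVED**: for `ψ⁶ ≠ 1` and `σ ∈ 𝔖₆`, the eigenclasses of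
`H⁴(X_ψ(ℂ); ℂ)` of exponent `(1,2,2,3,5,5)∘σ` and of the conjugate exponent are of Hodge type `(2,2)`
(`typeOneHodge_of_coneSpan` on the discharged leaf `Shioda1979_coneSpan_represents_left_holds`).
[cite: Katz2009, Lemma 3.1] [cite: Aoki1987, Thm. 1-4 (i) p. 388] [cite: AokiShioda1983, §2 (2.1)] -/
theorem typeOneHodge_proof :
    Summit.HodgeConjecture.HodgeConjecture.Theses.DworkReflectionQuotients.TypeOneHodge :=
  typeOneHodge_of_coneSpan Shioda1979_coneSpan_represents_left_holds

/-- **Crux K2 `FlatClassesSpannedByReflectionInvariants`, PROVED**: for `ψ⁶ ≠ 1`, every rational class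
`w = u + v` of a flat Katz piece `V_b(ψ) ⊕ V_{6-b}(ψ)` of `H⁴(X_ψ(ℂ); ℂ)` lies in the `ℂ`-span of the
rational `(2,2)`-classes fixed by a realised reflection `s_(i,j,ζ)`
(`flatClassesSpannedByReflectionInvariants_of_coneSpan` on `Shioda1979_coneSpan_represents_left_holds`;
behind it: det-free span `fixedSpan_eq_top`, CY top character `topCharacterTrivial_proof`, Fermat-point
purity by symmetry and by the cones of Aoki's Thm. 1-4 (i), equivariant transport to `X_ψ`).
[cite: Katz2009, §3 and Lemma 3.1] [cite: Aoki1987, Thm. 1-4 (i) p. 388 and p. 386]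
[cite: AokiShioda1983, §2 (2.1)] [cite: Shioda1979HodgeFermat, Thm. I] -/
theorem flatClassesSpannedByReflectionInvariants_proof :
    Summit.HodgeConjecture.HodgeConjecture.Theses.DworkReflectionQuotients.FlatClassesSpannedByReflectionInvariants :=
  flatClassesSpannedByReflectionInvariants_of_coneSpan Shioda1979_coneSpan_represents_left_holds

end Summit.HodgeConjecture.HodgeConjecture.Theorems
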